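import Summits.ResolutionOfSingularities.ResolutionOfSingularities.Theorems.WeightedInvariantLocalWeightedDropNCGameDecoratedWins

/-!
# Decorated winning regions from FINITE-ROUND wins: `DWinsTo.of_winsIn`

Crux item stmt-ResolutionOfSingularities-8899 `WeightedInvariant.LocalWeightedDrop` (route `ResolutionOfSingularities/WeightedInvariant`), ENGINE
skeleton v32, residual `stub_spaceNCRankDrop`, TOT2-LINE v1/v1.1 (res-L1-w43-lead-1) — piece S-END glue.  [OURS · L1 W4.3 · seat res-D-pv-006;
def-free; NOT a statement of any manuscript.]

The TOT rungs (R2/R5/R6/R7/R8, plane cylinders, …) and the endgame S-END are stated in ROUNDS: `WinsIn P n b`.  The assembly of TOT2-LINE runs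
on DECORATED states (`DWinsTo germ Q σ`, `…NCGameDecoratedWins`, p528575).  This file is the bridge: if the germ of a decorated state is won
within finitely many rounds, and every non-zero germ is carried by SOME decorated state (e.g. the bare decoration `(sqfRep (rad b), ∅, ∅)`),
then the state wins towards the target «its germ satisfies `P`» in the decorated sense — `DWinsTo.of_winsIn`; the region is «germ finitely
winnable», the measure is the least number of rounds.
-/

set_option linter.dupNamespace false -- mandated namespace of this single-conjunct summit

namespace Summit.ResolutionOfSingularities.ResolutionOfSingularities.Theorems

namespace TameFourTupleDrop

open MvPowerSeries Literature.AlgebraicGeometry.Resolution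

variable {k : Type} [Field k] {m : ℕ} {St : Type} {germ : St → MvPowerSeries (Fin (m + 1)) k}

/-- **FINITE-ROUND WINS ARE DECORATED WINS.**  If every non-zero germ is carried by some decorated state and decorated states carry non-zero
germs, then a state whose germ the mover wins within finitely many rounds (terminal predicate `P`) wins towards the target `P ∘ germ` in the
decorated sense. -/
theorem DWinsTo.of_winsIn {P : MvPowerSeries (Fin (m + 1)) k → Prop} (h0 : ∀ τ : St, germ τ ≠ 0)
    (hsurj : ∀ b : MvPowerSeries (Fin (m + 1)) k, b ≠ 0 → ∃ τ : St, germ τ = b) {σ : St} {n : ℕ} (hσ : WinsIn P n (germ σ)) :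
    DWinsTo germ (fun τ => P (germ τ)) σ := by
  classical
  -- region: the states whose germ is finitely winnable; measure: the least number of rounds
  refine DWinsTo.of_measure (germ := germ) {τ : St | ∃ n, WinsIn P n (germ τ)}
    (fun τ => if h : ∃ n, WinsIn P n (germ τ) then ((Nat.find h : ℕ) : Ordinal.{0}) else 0) ?_ ⟨n, hσ⟩
  intro τ hτ hP
  have hτ' : ∃ n, WinsIn P n (germ τ) := hτ
  -- the least number of rounds is positive and is attained by a move
  obtain ⟨N, hN⟩ : ∃ N, Nat.find hτ' = N + 1 := by
    have hne : Nat.find hτ' ≠ 0 := by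
      intro h
      have hw : WinsIn P (Nat.find hτ') (germ τ) := Nat.find_spec hτ'
      rw [h] at hw
      exact hP hw
    exact ⟨Nat.find hτ' - 1, by omega⟩
  have hw : WinsIn P (N + 1) (germ τ) := hN ▸ Nat.find_spec hτ'
  rcases hw with hw | ⟨Φ, w, hmv, hclause⟩
  · exact absurd (Nat.find_min' hτ' hw) (by omega)
  refine ⟨Φ, w, hmv, (MoveClause.and_ne_zero (h0 τ) hmv hclause).mono ?_⟩
  rintro b' ⟨hb', hwin'⟩
  obtain ⟨τ', hτ'b⟩ := hsurj b' hb'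
  have hex' : ∃ n, WinsIn P n (germ τ') := ⟨N, by rw [hτ'b]; exact hwin'⟩
  refine ⟨τ', hτ'b, Or.inr ⟨hex', ?_⟩⟩
  show (if h : ∃ n, WinsIn P n (germ τ') then ((Nat.find h : ℕ) : Ordinal.{0}) else 0) <
    (if h : ∃ n, WinsIn P n (germ τ) then ((Nat.find h : ℕ) : Ordinal.{0}) else 0)
  rw [dif_pos hex', dif_pos hτ', Nat.cast_lt, hN]
  exact Nat.lt_succ_of_le (Nat.find_min' hex' (by rw [hτ'b]; exact hwin'))

/-- The same with an explicit CARRIER of germs: a map `carry` producing, for every non-zero germ, a decorated state with that germ. -/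
theorem DWinsTo.of_winsIn' {P : MvPowerSeries (Fin (m + 1)) k → Prop} (h0 : ∀ τ : St, germ τ ≠ 0)
    (carry : ∀ b : MvPowerSeries (Fin (m + 1)) k, b ≠ 0 → St) (hcarry : ∀ b (hb : b ≠ 0), germ (carry b hb) = b)
    {σ : St} {n : ℕ} (hσ : WinsIn P n (germ σ)) : DWinsTo germ (fun τ => P (germ τ)) σ :=
  DWinsTo.of_winsIn h0 (fun b hb => ⟨carry b hb, hcarry b hb⟩) hσ

end TameFourTupleDrop

end Summit.ResolutionOfSingularities.ResolutionOfSingularities.Theorems
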